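import Summits.Ventures.PercRepro.C025ProfileRankFourFacts

/-!
# The rank-4 certificate: the bookkeeping lemmas shared by the (Cap) / (Dem) cases (night-3 g8)

Small facts used by every remaining case of NIGHT3-G7-RANK4-CERTIFICATE.md §2–§3: the complement rank `crk` as an
`ℕ∞`-rank (`eRk_gr_sdiff_eq_crk`), its bounds (`crk_le_of_eRank`, `crk_le_crk_add_one_of_sdiff_singleton`), the
evaluation of the rule `w4` on the three shapes that pay (`w4_of_sdiff_card_one_of_three_le_card`,
`w4_of_sdiff_card_one_of_card_two`, `w4_of_sdiff_card_two_of_card_two`), the vanishing cases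
(`w4n_eq_zero_of_crk_lt_three`, `w4n_eq_zero_of_sdiff_card_two_of_card_ne_two`), the upper bounds for a pair with two
points outside it (`w4n_le_third_of_sdiff_card_two_of_four_le_crk`, `w4n_le_sixth_of_sdiff_card_two_of_three_le_crk`,
`w4n_eq_zero_of_sdiff_card_two_of_crk_ne`), the simplicity bridge `simple_of_indep_two` (`ThmH.Simple` from the
girth-`3` form), and the membership facts of the (Cap) filter (`two_le_card_of_mem_Rq_two`, `ne_of_mem_filter_levelSet`).
-/

open scoped Matroid

namespace PercRepro

open Set Finset ThmH

section RankFourLemmas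

variable {α : Type} [DecidableEq α] {M : Matroid α} [M.Finite]

/-- The rank of the complement of `X` is `crk M X`, as an extended natural. -/
theorem eRk_gr_sdiff_eq_crk (X : Finset α) : M.eRk ((gr M \ X : Finset α) : Set α) = (crk M X : ℕ∞) := by
  have hfin : M.eRk ((gr M \ X : Finset α) : Set α) ≠ ⊤ := by
    rw [← lt_top_iff_ne_top]; exact (M.isRkFinite_set _).eRk_lt_top
  unfold crk; rw [ENat.coe_toNat hfin]

/-- `crk M X ≤ R` when the rank of `M` is `R`. -/
theorem crk_le_of_eRank {R : ℕ} (hR : M.eRank = (R : ℕ∞)) (X : Finset α) : crk M X ≤ R := by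
  have := M.eRk_le_eRank ((gr M \ X : Finset α) : Set α)
  rw [hR, eRk_gr_sdiff_eq_crk] at this
  exact_mod_cast this

/-- If `S ∖ B = {y}` then `ρ(E∖B) ≤ ρ(E∖S) + 1`. -/
theorem crk_le_crk_add_one_of_sdiff_singleton {B S : Finset α} {y : α} (h : S \ B = {y}) :
    crk M B ≤ crk M S + 1 := by
  have hsub : gr M \ B ⊆ insert y (gr M \ S) := by
    intro x hx
    rw [Finset.mem_sdiff] at hx
    rw [Finset.mem_insert, Finset.mem_sdiff]
    by_cases hxS : x ∈ S
    · left
      have : x ∈ S \ B := Finset.mem_sdiff.2 ⟨hxS, hx.2⟩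
      rw [h] at this
      exact Finset.mem_singleton.1 this
    · exact Or.inr ⟨hx.1, hxS⟩
  have h1 : M.eRk ((gr M \ B : Finset α) : Set α) ≤ M.eRk ((insert y (gr M \ S) : Finset α) : Set α) :=
    M.eRk_mono (Finset.coe_subset.2 hsub)
  have h2 : M.eRk ((insert y (gr M \ S) : Finset α) : Set α) ≤ M.eRk ((gr M \ S : Finset α) : Set α) + 1 := by
    rw [Finset.coe_insert]; exact M.eRk_insert_le_add_one _ _
  rw [eRk_gr_sdiff_eq_crk] at h1
  rw [eRk_gr_sdiff_eq_crk] at h2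
  have := h1.trans h2
  exact_mod_cast this

/-- Complements reverse inclusion: `B ⊆ S → crk M S ≤ crk M B`. -/
theorem crk_le_crk_of_subset {B S : Finset α} (h : B ⊆ S) : crk M S ≤ crk M B := by
  have := M.eRk_mono (Finset.coe_subset.2 (Finset.sdiff_subset_sdiff (Finset.Subset.refl (gr M)) h))
  rw [eRk_gr_sdiff_eq_crk, eRk_gr_sdiff_eq_crk] at this
  exact_mod_cast this

/-- The rule on a set with one extra point over a rank-`2` set with at least three points. -/
theorem w4_of_sdiff_card_one_of_three_le_card {B S : Finset α} (he : (S \ B).card = 1) (hB3 : 3 ≤ B.card)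
    (hp : 3 ≤ crk M B) : w4 M B S = (crk M B : ℚ) / ((crk M S : ℚ) + 1 - (jB M B : ℚ)) := by
  unfold w4
  simp only
  rw [if_neg (by omega : ¬ crk M B < 3), if_pos he, if_pos hB3]

/-- The rule on a set with one extra point over a pair. -/
theorem w4_of_sdiff_card_one_of_card_two {B S : Finset α} (he : (S \ B).card = 1) (hB2 : B.card = 2)
    (hp : 3 ≤ crk M B) : w4 M B S =
      (if jB M B = 0 then (crk M B : ℚ) / ((crk M S : ℚ) + 1)
       else if jB M B = 1 then 1
       else if crk M S + 1 = crk M B then 3 / 2 else 1) := by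
  unfold w4
  simp only
  rw [if_neg (by omega : ¬ crk M B < 3), if_pos he, if_neg (by omega : ¬ 3 ≤ B.card)]

/-- The rule on a set with two extra points over a pair. -/
theorem w4_of_sdiff_card_two_of_card_two {B S : Finset α} (he : (S \ B).card = 2) (hB2 : B.card = 2)
    (hp : 3 ≤ crk M B) : w4 M B S =
      (if jB M B = 1 ∧ crk M S + 2 = crk M B then 1 / ((crk M B : ℚ) - 1)
       else if jB M B = 2 ∧ crk M B = 4 then
         (if crk M S = 2 then 1 / 4 else if crk M S = 3 then 1 / 6 else if crk M S = 4 then 1 / 9 else 0)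
       else 0) := by
  unfold w4
  simp only
  rw [if_neg (by omega : ¬ crk M B < 3), if_neg (by omega : ¬ (S \ B).card = 1), if_pos ⟨he, hB2⟩]

/-- Nothing is paid to a set whose complement has rank `< 3`. -/
theorem w4n_eq_zero_of_crk_lt_three {B S : Finset α} (hp : crk M B < 3) : w4n M B S = 0 := by
  unfold w4n w4
  simp only
  rw [if_pos hp, max_self]

/-- A set with exactly two extra points over a rank-`2` set that is not a pair is paid nothing. -/
theorem w4n_eq_zero_of_sdiff_card_two_of_card_ne_two {B S : Finset α} (he : (S \ B).card = 2) (hB : B.card ≠ 2) :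
    w4n M B S = 0 := by
  unfold w4n w4
  simp only
  have h1 : (S \ B).card ≠ 1 := by omega
  have h2 : ¬ ((S \ B).card = 2 ∧ B.card = 2) := fun h => hB h.2
  split_ifs <;> simp

/-- A pair with two extra points and `ρ(E∖B) ≥ 4` is paid at most `1/3`. -/
theorem w4n_le_third_of_sdiff_card_two_of_four_le_crk {B S : Finset α} (he : (S \ B).card = 2) (hB2 : B.card = 2)
    (hp : 4 ≤ crk M B) : w4n M B S ≤ 1 / 3 := by
  unfold w4n
  rw [w4_of_sdiff_card_two_of_card_two he hB2 (by omega)]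
  have hp4 : (4 : ℚ) ≤ (crk M B : ℚ) := by exact_mod_cast hp
  apply max_le (by norm_num)
  split_ifs
  · rw [div_le_div_iff₀ (by linarith) (by norm_num)]; linarith
  all_goals norm_num

/-- A pair with two extra points, `ρ(E∖B) ≤ 4` and `ρ(E∖S) ≥ 3` is paid at most `1/6`. -/
theorem w4n_le_sixth_of_sdiff_card_two_of_three_le_crk {B S : Finset α} (he : (S \ B).card = 2) (hB2 : B.card = 2)
    (hp : crk M B ≤ 4) (hr : 3 ≤ crk M S) : w4n M B S ≤ 1 / 6 := by
  by_cases hp3 : crk M B < 3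
  · rw [w4n_eq_zero_of_crk_lt_three hp3]; norm_num
  unfold w4n
  rw [w4_of_sdiff_card_two_of_card_two he hB2 (by omega)]
  apply max_le (by norm_num)
  split_ifs with h1 h2 h3 h4 h5
  · exfalso; omega
  · exfalso; omega
  · norm_num
  · norm_num
  · norm_num
  · norm_num

/-- A pair with two extra points is paid nothing unless `ρ(E∖B) = ρ(E∖S) + 2` or `ρ(E∖B) = 4`. -/
theorem w4n_eq_zero_of_sdiff_card_two_of_crk_ne {B S : Finset α} (he : (S \ B).card = 2) (hB2 : B.card = 2)
    (h1 : crk M S + 2 ≠ crk M B) (h2 : crk M B ≠ 4) : w4n M B S = 0 := by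
  by_cases hp3 : crk M B < 3
  · exact w4n_eq_zero_of_crk_lt_three hp3
  unfold w4n
  rw [w4_of_sdiff_card_two_of_card_two he hB2 (by omega)]
  rw [if_neg (fun h => h1 h.2), if_neg (fun h => h2 h.2), max_self]

/-- A pair with two extra points on a two-point line (`j(B) = 0`) is paid nothing. -/
theorem w4n_eq_zero_of_sdiff_card_two_of_jB_eq_zero {B S : Finset α} (he : (S \ B).card = 2) (hB2 : B.card = 2)
    (hj : jB M B = 0) : w4n M B S = 0 := by
  by_cases hp3 : crk M B < 3
  · exact w4n_eq_zero_of_crk_lt_three hp3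
  unfold w4n
  rw [w4_of_sdiff_card_two_of_card_two he hB2 (by omega)]
  rw [if_neg (fun h => by rw [hj] at h; exact absurd h.1 zero_ne_one),
    if_neg (fun h => by rw [hj] at h; exact absurd h.1 (by decide)), max_self]

omit [DecidableEq α] [M.Finite] in
/-- The girth-`3` form of simplicity gives `ThmH.Simple`. -/
theorem simple_of_indep_two (hsimple : ∀ T ⊆ M.E, T.encard ≤ 2 → M.Indep T) : ThmH.Simple M := by
  intro e he f hf hef
  have hsub : ({e, f} : Set α) ⊆ M.E := by
    intro z hz; rw [Set.mem_insert_iff, Set.mem_singleton_iff] at hz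
    rcases hz with rfl | rfl
    · exact he
    · exact hf
  have hind := hsimple _ hsub (by rw [Set.encard_pair hef])
  rw [hind.eRk_eq_encard, Set.encard_pair hef]

omit [DecidableEq α] in
/-- A rank-`2` set has at least two points. -/
theorem two_le_card_of_mem_Rq_two {B : Finset α} (hB : B ∈ Profile.Rq M 2) : 2 ≤ B.card := by
  rw [Profile.mem_Rq] at hB
  have h1 : M.eRk (B : Set α) ≤ (B : Set α).encard := M.eRk_le_encard _
  rw [hB.2, Set.encard_coe_eq_coe_finsetCard] at h1
  exact_mod_cast h1

/-- A rank-`2` subset of a rank-`3` set is a proper subset. -/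
theorem ne_of_mem_filter_levelSet {B S : Finset α} (hS : S ∈ Shadow.levelSet M 3)
    (hB : B ∈ (Profile.Rq M 2).filter (fun B => B ⊆ S)) : B ≠ S := by
  rintro rfl
  rw [Finset.mem_filter, Profile.mem_Rq] at hB
  rw [Profile.mem_levelSet] at hS
  rw [hS.2] at hB
  exact absurd hB.1.2 (by decide)

omit [DecidableEq α] in
/-- In a simple matroid, a set containing two distinct points of the ground set has rank at least `2`. -/
theorem two_le_eRk_of_pair_subset (hsimple : ∀ T ⊆ M.E, T.encard ≤ 2 → M.Indep T) {X : Finset α} (hX : X ⊆ gr M)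
    {a b : α} (ha : a ∈ X) (hb : b ∈ X) (hab : a ≠ b) : (2 : ℕ∞) ≤ M.eRk (X : Set α) :=
  two_le_eRk_of_two_mem (simple_of_indep_two hsimple) hX ha hb hab

omit [DecidableEq α] in
/-- In a simple matroid, a subset of the ground set of rank at most `1` has at most one point. -/
theorem card_le_one_of_eRk_le_one (hsimple : ∀ T ⊆ M.E, T.encard ≤ 2 → M.Indep T) {X : Finset α} (hX : X ⊆ gr M)
    (h : M.eRk (X : Set α) ≤ 1) : X.card ≤ 1 := by
  rw [Finset.card_le_one]
  intro a ha b hb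
  by_contra hab
  have := two_le_eRk_of_pair_subset hsimple hX ha hb hab
  have h2 : (2 : ℕ∞) ≤ 1 := this.trans h
  exact absurd h2 (by decide)

end RankFourLemmas

end PercRepro
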